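import Summits.BirchSwinnertonDyer.BirchSwinnertonDyer.Theorems.GenusKolyvaginAtTwoPowDvdShaCardAtTwoRTBottomRungSocket
import Summits.BirchSwinnertonDyer.BirchSwinnertonDyer.Theorems.GenusKolyvaginAtTwoPowDvdShaCardAtTwoRTBottomRungTransverseSocket
import Summits.BirchSwinnertonDyer.BirchSwinnertonDyer.Theorems.GenusKolyvaginAtTwoPowDvdShaCardAtTwoRTPowDvdShaCardOfGrossWitnessOrth
import HarnessLib

/-!
# Route `GenusKolyvaginAtTwo`, LINE 26 «lw2_phantom_exclusion» of the residual crux `OffCutResidualAtTwoR` (stmt-BirchSwinnertonDyer-31767):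
# the FLAT re-thread — part A3: **the bottom-rung socket and the Kolyvagin-supplies package of road (E4), Δ<0, from `(NPh at 2N)` instead of an odd multiplicative prime**

Seat `bsd-line-gk2-p5` g40 (WIDTH-5 attach, cell `bsd-f1-sign2`), `--supports stmt-BirchSwinnertonDyer-31767` (helper; closes nothing).
THEOREMS ONLY (no definition, no named fact, no `sorry`).  **BSD is NOT proved by any of this**; the residual crux is NOT closed by it.

WHY.  LINE 26 (`Cruxes/OffCutResidualAtTwoR/Lines/lw2_phantom_exclusion.lean`, stubs `stub_Q3flat` / `stub_Q4flat`) asks for the LANDED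
exactness theorems Q3R_T (`…Theorems.equivariantKolyvaginExactAtTwoRT_proof`) and Q4_T″ (`…Theorems.kolyvaginExactAtTwoPosDiscT_proof`) with
their binder quadruple `(v) (h2v : 2 ∉ v) (hNv : N ∈ v) (hmult : E multiplicative at v)` REPLACED by the hypothesis it was only ever used to
derive (critic #471 P1 census, card §7: 10 entry points, 36 pass-through signatures, 0 other uses of `v`):
`(NPh at 2N)(E, K)` := «for every `M ≥ 1`, a class of `H¹(K, E[2^M])` that dies on `Γ_(K(E[2^M]))` and is Kummer at every place over `2N`
is `0`» — VERBATIM the conclusion of `GenusExact.NonPhantomPow.nonPhantomAtTwo_of_hasMultiplicativeReductionAt` (with `N := N_E`).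
Proofs below are the landed ones VERBATIM except that (i) the binder quadruple is gone and `hNPh` is inserted right after the two
`¬ IsSquare` clauses (where `K` is in scope), (ii) at the entry points the local `(NPh_M)` is read off `hNPh` instead of the multiplicative
prime, (iii) callees are the `_flat` siblings.  Decl names = originals + `_flat`; namespaces unchanged.

WHAT (this part).  The bottom-rung SOCKET of road (E4) on the Δ<0 habitat and its consumers: gk2-p3's `RelaxedCount.hbot_socket_margin_onHabitat`,
gk2-p2's `TransverseValue.hbot_socket_margin_onHabitat_of_three_le`, and the Kolyvagin-supplies provenance package
`kolyvaginSuppliesAtTwo_of_grossWitness_onHabitat_pred` (entry points: the single-level `(NPh_(L+k))` is now `hNPh (L + k)`).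

References: [GrossLMS1991] §1, §5, §10; [Kolyvagin1990] Thm. A; [McCallumLMS1991] §1, §3, §5; [Kramer1981] Thm. 1; [LawsonWuthrich2016] §4, §8
(the level-2 phantom class that supplies `(NPh at 2N)` off the cut — LINE 26 stubs `stub_KLW` / `stub_transport`, other seats).
-/

set_option autoImplicit false
-- the Theorems namespace of this sub repeats the summit name by design (D-0017 nested layout)
set_option linter.dupNamespace false

noncomputable section

/-! ## from `GenusKolyvaginAtTwoPowDvdShaCardAtTwoRTBottomRungSocket` -/

open scoped Classical

open Field NumberField IsDedekindDomain Function WeierstrassCurve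
open Literature.NumberTheory.EllipticCurves
open Literature.NumberTheory.GaloisRepresentations
open Literature.NumberTheory.GaloisCohomology
open Summit.BirchSwinnertonDyer.BirchSwinnertonDyer.Theses.GenusKolyvaginAtTwo (KolyvaginRelationAtTwo)

namespace Summit.BirchSwinnertonDyer.BirchSwinnertonDyer.Theorems.GenusExact.RelaxedCount

variable (W : WeierstrassCurve ℚ) [W.IsElliptic] [W.IsGloballyMinimal] [NeZero (W.conductorNorm ℤ)]
  {K : Type} [Field K] [NumberField K]

/-- (LINE 26 FLAT form: the hypothesis `(NPh at 2N)(E, K)` replaces the odd multiplicative prime `v`.) **THE SOCKET `hbot`, margin-`k` class, ON THE CUT HABITAT** («∃ odd place `v ∣ N` of multiplicative reduction», director (D-NPh)): as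
`hbot_socket_margin`, with (NPh) DISCHARGED by gk2-p3's `nonPhantomAtTwo_of_hasMultiplicativeReductionAt`, the witness in Kolyvagin's divisibility
currency `P(n₀) ∉ 2E(K[n₀])`, and LEVEL-2 Gross primes of index `≥ 2` (the level-4 condition follows on `Δ < 0` with the 2-adic tower onto,
gk2-p5 g22).  Displayed residuals: the (V44)-socket `hTr` at level `L + k` and Q2.
[cite: McCallumLMS1991, §5 Prop. 5.2 and its proof, p. 285] [cite: GrossLMS1991, §3 (3.3)] -/
theorem hbot_socket_margin_onHabitat_flat (hQ2 : KolyvaginRelationAtTwo) (hcm : ¬ W.HasCM) (hΔ : W.Δ < 0)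
    (hT : Odd W.tamagawaProduct) (hρ : ∀ m : ℕ, W.HasSurjectiveModNGaloisRep (2 ^ m : ℕ))
    (hK : IsImaginaryQuadratic K) (hodd : Odd (NumberField.discr K)) (h3 : NumberField.discr K ≠ -3)
    (hHe : SatisfiesHeegnerHypothesis (W.conductorNorm ℤ) K) (hns : ¬ IsSquare ((NumberField.discr K : ℚ) * -|W.Δ|))
    (_hns₂ : ¬ IsSquare ((NumberField.discr K : ℚ) * (-(2 * |W.Δ|))))
    (hNPh : ∀ (Mlev : ℕ), 1 ≤ Mlev → ∀ z : galH1Torsion (W.baseChange K) ((2 ^ Mlev : ℕ) : ℤ),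
      (∀ ρ ∈ torsionFixing (W.baseChange K) ((2 ^ Mlev : ℕ) : ℤ), h1Eval (W.baseChange K) ((2 ^ Mlev : ℕ) : ℤ) z ρ = 0) →
      (∀ w : HeightOneSpectrum (𝓞 K), ((2 * W.conductorNorm ℤ : ℕ) : 𝓞 K) ∈ w.asIdeal →
        z ∈ selmerLocalKer (W.baseChange K) (w.adicCompletion K) ((2 ^ Mlev : ℕ) : ℤ)) → z = 0)
    (Dt : ModularForms.ModularParametrizationData W (W.conductorNorm ℤ)) (β : ℤ) (ι : K →+* ℂ) {L : ℕ} (hL2 : 2 ≤ L) (k : ℕ)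
    (hTr : ∀ (n' : ℕ) (d' : KolyvaginHeegnerData Dt β ι n') (Z : galoisCohomology (W.torsionGaloisModule ((2 ^ 2 : ℕ) : ℤ)) 1),
      Squarefree n' →
      (∀ q ∈ n'.primeFactors, Zhang2014.IsKolyvaginPrime (W.conductorNorm ℤ) W K 2 q ∧ 2 ≤ Zhang2014.kolyvaginIndex W 2 q ∧
        FrobEqFrobInfty W K (2 ^ 2) q) →
      resTorsion W K ((2 ^ 2 : ℕ) : ℤ) Z = d'.kolyvaginClass Nat.prime_two 2 →
      ∀ (v : HeightOneSpectrum (𝓞 ℚ)) (ℓ : ℕ), ℓ ∈ n'.primeFactors → (ℓ : 𝓞 ℚ) ∈ v.asIdeal →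
        L + k ≤ Zhang2014.kolyvaginIndex W 2 ℓ → FrobEqFrobInfty W K (2 ^ (L + k)) ℓ →
        ∀ 𝔓 ∈ v.primesAbove, ∀ F c₀ : absoluteGaloisGroup ℚ, IsArithFrobAt (𝓞 ℚ) F 𝔓 →
          IsComplexConjugation (Rat.castHom ℝ) c₀ → (∀ P : geomTorsion W ((2 ^ 2 : ℕ) : ℤ), F • P = c₀ • P) →
          ∃ P₁ : geomTorsion W ((2 ^ 2 : ℕ) : ℤ), h1Eval W _ ((2 : ℕ) • Z) F = F • P₁ - P₁)
    (G : ℕ → Prop)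
    (hG : ∀ q : ℕ, Zhang2014.IsKolyvaginPrime (W.conductorNorm ℤ) W K 2 q → L + k ≤ Zhang2014.kolyvaginIndex W 2 q →
      FrobEqFrobInfty W K (2 ^ (L + k)) q → G q)
    {n₀ : ℕ} (hn₀ : Squarefree n₀)
    (hn₀K : ∀ q ∈ n₀.primeFactors, Zhang2014.IsKolyvaginPrime (W.conductorNorm ℤ) W K 2 q ∧ 2 ≤ Zhang2014.kolyvaginIndex W 2 q ∧
      FrobEqFrobInfty W K 2 q)
    (e₀ : KolyvaginHeegnerData Dt β ι n₀)
    (he₀ : ¬ ∃ Q : (W.baseChange (ringClassField K ι n₀)).toAffine.Point, (2 : ℤ) • Q = e₀.derivedPoint) :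
    ∃ (n : ℕ) (d : KolyvaginHeegnerData Dt β ι n), Squarefree n ∧
      (∀ q ∈ n.primeFactors, (Zhang2014.IsKolyvaginPrime (W.conductorNorm ℤ) W K 2 q ∧ L ≤ Zhang2014.kolyvaginIndex W 2 q) ∧ G q) ∧
      addOrderOf (d.kolyvaginClass Nat.prime_two L) = 2 ^ L := by
  have hρ2 : W.HasSurjectiveModNGaloisRep 2 := by simpa using hρ 1
  have hNPh := hNPh (L + k) (by omega)
  have hn₀K' : ∀ q ∈ n₀.primeFactors, Zhang2014.IsKolyvaginPrime (W.conductorNorm ℤ) W K 2 q ∧ 2 ≤ Zhang2014.kolyvaginIndex W 2 q ∧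
      FrobEqFrobInfty W K (2 ^ 2) q := fun q hq ↦
    ⟨(hn₀K q hq).1, (hn₀K q hq).2.1, GrossLevelAtTwo.frobEqFrobInfty_two_pow_of_frobEqFrobInfty_two W K hK hΔ (M := 2) (by norm_num)
      (hρ 2) (hn₀K q hq).1 (hn₀K q hq).2.1 (hn₀K q hq).2.2⟩
  have he₀' : addOrderOf (e₀.kolyvaginClass Nat.prime_two 2) = 2 ^ 2 :=
    addOrderOf_kolyvaginClass_two_eq_pow_of_not_two_dvd_single W hK hodd h3 hHe hρ2 Dt β ι (M := 2) (by norm_num) hn₀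
      (fun q hq ↦ ⟨(hn₀K' q hq).1, (hn₀K' q hq).2.1⟩) e₀ he₀
  exact hbot_socket_margin W hQ2 hcm hΔ hT hρ hK hodd h3 hHe hns Dt β ι hL2 k hNPh hTr G hG hn₀ hn₀K' e₀ he₀'

end Summit.BirchSwinnertonDyer.BirchSwinnertonDyer.Theorems.GenusExact.RelaxedCount

/-! ## from `GenusKolyvaginAtTwoPowDvdShaCardAtTwoRTBottomRungTransverseSocket` -/

open scoped Classical Pointwise

open WeierstrassCurve NumberField IsDedekindDomain Field
open Literature.NumberTheory.EllipticCurves Literature.NumberTheory.GaloisRepresentations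
open Literature.NumberTheory.GaloisCohomology
open Literature.NumberTheory.EllipticCurves.ModularForms
open Summit.BirchSwinnertonDyer.Rank1Residual
open Summit.BirchSwinnertonDyer.BirchSwinnertonDyer.Theses.GenusKolyvaginAtTwo (KolyvaginRelationAtTwo)

namespace Summit.BirchSwinnertonDyer.BirchSwinnertonDyer.Theorems.GenusExact.TransverseValue

section KSide

variable {K : Type} [Field K] [NumberField K] (W : WeierstrassCurve ℚ) [W.IsElliptic] [W.IsGloballyMinimal]
  [NeZero (W.conductorNorm ℤ)]

/-- (LINE 26 FLAT form: the hypothesis `(NPh at 2N)(E, K)` replaces the odd multiplicative prime `v`.) **§3 THE SOCKET `hbot`, margin-`k` class, ON THE CUT HABITAT, WITH `hTr` DISCHARGED**: gk2-p5 g24's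
`RelaxedCount.hbot_socket_margin_onHabitat_flat` («∃ odd place `v ∣ N` of multiplicative reduction», (NPh) discharged by
`nonPhantomAtTwo_of_hasMultiplicativeReductionAt`, witness `P(n₀) ∉ 2E(K[n₀])`, level-2 Gross primes of index `≥ 2`) composed with
`hTr_of_three_le`.  Displayed residual: Q2 only. [cite: McCallumLMS1991, §5 Prop. 5.2 and its proof, p. 285] [cite: GrossLMS1991, §3 (3.3)] -/
theorem hbot_socket_margin_onHabitat_of_three_le_flat (hQ2 : KolyvaginRelationAtTwo) (hcm : ¬ W.HasCM) (hΔ : W.Δ < 0)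
    (hT : Odd W.tamagawaProduct) (hρ : ∀ m : ℕ, W.HasSurjectiveModNGaloisRep (2 ^ m : ℕ))
    (hK : IsImaginaryQuadratic K) (hodd : Odd (NumberField.discr K)) (h3 : NumberField.discr K ≠ -3)
    (hHe : SatisfiesHeegnerHypothesis (W.conductorNorm ℤ) K) (hns : ¬ IsSquare ((NumberField.discr K : ℚ) * -|W.Δ|))
    (hns₂ : ¬ IsSquare ((NumberField.discr K : ℚ) * (-(2 * |W.Δ|))))
    (hNPh : ∀ (Mlev : ℕ), 1 ≤ Mlev → ∀ z : galH1Torsion (W.baseChange K) ((2 ^ Mlev : ℕ) : ℤ),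
      (∀ ρ ∈ torsionFixing (W.baseChange K) ((2 ^ Mlev : ℕ) : ℤ), h1Eval (W.baseChange K) ((2 ^ Mlev : ℕ) : ℤ) z ρ = 0) →
      (∀ w : HeightOneSpectrum (𝓞 K), ((2 * W.conductorNorm ℤ : ℕ) : 𝓞 K) ∈ w.asIdeal →
        z ∈ selmerLocalKer (W.baseChange K) (w.adicCompletion K) ((2 ^ Mlev : ℕ) : ℤ)) → z = 0)
    (Dt : ModularParametrizationData W (W.conductorNorm ℤ)) (β : ℤ) (ι : K →+* ℂ)
    [∀ j : ℕ, NumberField (ringClassField K ι j)] {L : ℕ} (hL2 : 2 ≤ L) (k : ℕ) (hLk : 3 ≤ L + k)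
    (G : ℕ → Prop)
    (hG : ∀ q : ℕ, Zhang2014.IsKolyvaginPrime (W.conductorNorm ℤ) W K 2 q → L + k ≤ Zhang2014.kolyvaginIndex W 2 q →
      FrobEqFrobInfty W K (2 ^ (L + k)) q → G q)
    {n₀ : ℕ} (hn₀ : Squarefree n₀)
    (hn₀K : ∀ q ∈ n₀.primeFactors, Zhang2014.IsKolyvaginPrime (W.conductorNorm ℤ) W K 2 q ∧ 2 ≤ Zhang2014.kolyvaginIndex W 2 q ∧
      FrobEqFrobInfty W K 2 q)
    (e₀ : KolyvaginHeegnerData Dt β ι n₀)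
    (he₀ : ¬ ∃ Q : (W.baseChange (ringClassField K ι n₀)).toAffine.Point, (2 : ℤ) • Q = e₀.derivedPoint) :
    ∃ (n : ℕ) (d : KolyvaginHeegnerData Dt β ι n), Squarefree n ∧
      (∀ q ∈ n.primeFactors, (Zhang2014.IsKolyvaginPrime (W.conductorNorm ℤ) W K 2 q ∧ L ≤ Zhang2014.kolyvaginIndex W 2 q) ∧ G q) ∧
      addOrderOf (d.kolyvaginClass Nat.prime_two L) = 2 ^ L :=
  RelaxedCount.hbot_socket_margin_onHabitat_flat W hQ2 hcm hΔ hT hρ hK hodd h3 hHe hns hns₂ hNPh Dt β ι hL2 k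
    (hTr_of_three_le W hK hodd h3 hΔ Dt β ι hLk) G hG hn₀ hn₀K e₀ he₀

end KSide

end Summit.BirchSwinnertonDyer.BirchSwinnertonDyer.Theorems.GenusExact.TransverseValue

/-! ## from `GenusKolyvaginAtTwoPowDvdShaCardAtTwoRTPowDvdShaCardOfGrossWitnessOrth` -/

open scoped Classical
open scoped AddSubgroup

namespace Summit.BirchSwinnertonDyer.BirchSwinnertonDyer.Theorems.GenusExact.PlusDescent

open WeierstrassCurve NumberField IsDedekindDomain Field Literature.NumberTheory.EllipticCurves
  Literature.NumberTheory.GaloisRepresentations Literature.NumberTheory.EllipticCurves.ModularForms AddSubgroup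
open Summit.BirchSwinnertonDyer.BirchSwinnertonDyer.Theses.GenusKolyvaginAtTwo (KolyvaginRelationAtTwo)
open Summit.BirchSwinnertonDyer.Rank1Residual

variable {K : Type} [Field K] [NumberField K]

/-- (LINE 26 FLAT form: the hypothesis `(NPh at 2N)(E, K)` replaces the odd multiplicative prime `v`.) **KS's registered conclusion WITH PROVENANCE ON THE CUT HABITAT** (odd multiplicative place: (NPh) discharged by
`NonPhantomPow.nonPhantomAtTwo_of_hasMultiplicativeReductionAt`; witness = level-`2` Gross primes of index `≥ 2` with `P(n₀) ∉ 2E(K[n₀])`) —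
gk2-p3's `kolyvaginSuppliesAtTwo_of_grossWitness_onHabitat` (p735895) re-run through `kolyvaginSuppliesAtTwo_of_deepSwap_pred`.
[cite: McCallumLMS1991, §5 Prop. 5.2] [cite: Kolyvagin1991MathAnn, Thm. 2.1–2.2] [cite: GrossLMS1991, §3 (3.3)] [cite: LawsonWuthrich2016, §7.1] -/
theorem kolyvaginSuppliesAtTwo_of_grossWitness_onHabitat_pred_flat (W : WeierstrassCurve ℚ) [W.IsElliptic] [W.IsGloballyMinimal]
    [NeZero (W.conductorNorm ℤ)]
    (hQ2 : KolyvaginRelationAtTwo) (hcm : ¬ W.HasCM) (hΔ : W.Δ < 0) (hT : Odd W.tamagawaProduct)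
    (hρ : ∀ m : ℕ, W.HasSurjectiveModNGaloisRep (2 ^ m : ℕ))
    (hIQ : IsImaginaryQuadratic K) (hodd : Odd (NumberField.discr K)) (h3 : NumberField.discr K ≠ -3)
    (hHe : SatisfiesHeegnerHypothesis (W.conductorNorm ℤ) K) (hns : ¬ IsSquare ((NumberField.discr K : ℚ) * -|W.Δ|))
    (hns₂ : ¬ IsSquare ((NumberField.discr K : ℚ) * (-(2 * |W.Δ|))))
    (hNPh : ∀ (Mlev : ℕ), 1 ≤ Mlev → ∀ z : galH1Torsion (W.baseChange K) ((2 ^ Mlev : ℕ) : ℤ),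
      (∀ ρ ∈ torsionFixing (W.baseChange K) ((2 ^ Mlev : ℕ) : ℤ), h1Eval (W.baseChange K) ((2 ^ Mlev : ℕ) : ℤ) z ρ = 0) →
      (∀ w : HeightOneSpectrum (𝓞 K), ((2 * W.conductorNorm ℤ : ℕ) : 𝓞 K) ∈ w.asIdeal →
        z ∈ selmerLocalKer (W.baseChange K) (w.adicCompletion K) ((2 ^ Mlev : ℕ) : ℤ)) → z = 0)
    (τ : K ≃ₐ[ℚ] K) (hτ : τ ≠ 1)
    (Dt : ModularParametrizationData W (W.conductorNorm ℤ)) (β : ℤ) (ι : K →+* ℂ)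
    (d₁ : KolyvaginHeegnerData Dt β ι 1) (M₀ : ℕ)
    (hM₀ : ∃ Q : (W.baseChange (ringClassField K ι 1)).toAffine.Point, ((2 ^ M₀ : ℕ) : ℤ) • Q = d₁.derivedPoint)
    (hndiv : ¬ ∃ Q : (W.baseChange (ringClassField K ι 1)).toAffine.Point, ((2 ^ (M₀ + 1) : ℕ) : ℤ) • Q = d₁.derivedPoint)
    {L k : ℕ} (hL : 2 * M₀ + 12 ≤ L) (hk : 1 ≤ k)
    {n₀ : ℕ} (hn₀ : Squarefree n₀)
    (hn₀K : ∀ q ∈ n₀.primeFactors, Zhang2014.IsKolyvaginPrime (W.conductorNorm ℤ) W K 2 q ∧ 2 ≤ Zhang2014.kolyvaginIndex W 2 q ∧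
      FrobEqFrobInfty W K 2 q)
    (e₀ : KolyvaginHeegnerData Dt β ι n₀)
    (he₀ : ¬ ∃ Q : (W.baseChange (ringClassField K ι n₀)).toAffine.Point, (2 : ℤ) • Q = e₀.derivedPoint) :
    ∃ (R : ℕ) (Mr : ℕ → ℕ), (∀ j, Mr (j + 1) ≤ Mr j) ∧ Mr 0 = M₀ ∧ Mr R = 0 ∧
      (∀ m : ℕ, Mr (2 * m + 1) < Mr (2 * m) →
        ∀ (i : ℕ) (u : Fin i → galH1Torsion (W.baseChange K) ((2 ^ L : ℕ) : ℤ)), i ≤ 2 * m + 1 →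
        (∀ j, u j ∈ selmerGroup (W.baseChange K) ((2 ^ L : ℕ) : ℤ) ∧
          conjAct W τ ((2 ^ L : ℕ) : ℤ) (u j) = W.rootNumber • u j) →
        ∃ (n : ℕ) (_ : Squarefree n)
          (_ : ∀ ℓ ∈ n.primeFactors, Zhang2014.IsKolyvaginPrime (W.conductorNorm ℤ) W K 2 ℓ ∧ L ≤ Zhang2014.kolyvaginIndex W 2 ℓ ∧
            (L + k ≤ Zhang2014.kolyvaginIndex W 2 ℓ ∧ FrobEqFrobInfty W K (2 ^ (L + k)) ℓ))
          (d : KolyvaginHeegnerData Dt β ι n),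
          (∀ ℓ ∈ n.primeFactors, ∀ e : KolyvaginHeegnerData Dt β ι (n / ℓ),
            ((2 ^ (L - Mr (2 * m)) : ℕ) : ℤ) • e.kolyvaginClass Nat.prime_two L = 0) ∧
          addOrderOf (d.kolyvaginClass Nat.prime_two L) = 2 ^ (L - Mr (2 * m + 1)) ∧
          -W.rootNumber * (-1) ^ n.primeFactors.card = W.rootNumber ∧
          Disjoint (zmultiples (((2 ^ (L - Mr (2 * m)) : ℕ) : ℤ) • d.kolyvaginClass Nat.prime_two L))
            (AddSubgroup.closure (Set.range u))) ∧
      (∀ m : ℕ, Mr (2 * m + 2) < Mr (2 * m + 1) →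
        ∀ (i : ℕ) (u : Fin i → galH1Torsion (W.baseChange K) ((2 ^ L : ℕ) : ℤ)), i ≤ 2 * m + 1 →
        (∀ j, u j ∈ selmerGroup (W.baseChange K) ((2 ^ L : ℕ) : ℤ) ∧
          conjAct W τ ((2 ^ L : ℕ) : ℤ) (u j) = (-W.rootNumber) • u j) →
        ∃ (n : ℕ) (_ : Squarefree n)
          (_ : ∀ ℓ ∈ n.primeFactors, Zhang2014.IsKolyvaginPrime (W.conductorNorm ℤ) W K 2 ℓ ∧ L ≤ Zhang2014.kolyvaginIndex W 2 ℓ ∧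
            (L + k ≤ Zhang2014.kolyvaginIndex W 2 ℓ ∧ FrobEqFrobInfty W K (2 ^ (L + k)) ℓ))
          (d : KolyvaginHeegnerData Dt β ι n),
          (∀ ℓ ∈ n.primeFactors, ∀ e : KolyvaginHeegnerData Dt β ι (n / ℓ),
            ((2 ^ (L - Mr (2 * m + 1)) : ℕ) : ℤ) • e.kolyvaginClass Nat.prime_two L = 0) ∧
          addOrderOf (d.kolyvaginClass Nat.prime_two L) = 2 ^ (L - Mr (2 * m + 2)) ∧
          -W.rootNumber * (-1) ^ n.primeFactors.card = -W.rootNumber ∧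
          Disjoint (zmultiples (((2 ^ (L - Mr (2 * m + 1)) : ℕ) : ℤ) • d.kolyvaginClass Nat.prime_two L))
            (AddSubgroup.closure (Set.range u) ⊔ zmultiples (d₁.kolyvaginClass Nat.prime_two L))) := by
  haveI : ∀ j : ℕ, NumberField (ringClassField K ι j) := JET.numberField_ringClassField K hIQ ι
  have hNPhL := hNPh (L + k) (by omega)
  exact kolyvaginSuppliesAtTwo_of_deepSwap_pred W hQ2 hcm hΔ hT hρ hIQ hodd h3 hHe hns τ hτ Dt β ι d₁ M₀ hM₀ hndiv (L := L)
    (by omega) k (fun z hz hzS ↦ hNPhL z hz fun w _ ↦ hzS w)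
    (fun q ↦ L + k ≤ Zhang2014.kolyvaginIndex W 2 q ∧ FrobEqFrobInfty W K (2 ^ (L + k)) q) (fun q _ hidx hF ↦ ⟨hidx, hF⟩)
    (TransverseValue.hbot_socket_margin_onHabitat_of_three_le_flat W hQ2 hcm hΔ hT hρ hIQ hodd h3 hHe hns hns₂ hNPh Dt β ι
      (L := L) (by omega) k (by omega) _ (fun q _ hidx hF ↦ ⟨hidx, hF⟩) hn₀ hn₀K e₀ he₀)
    (deepSwap_socket W hcm hΔ hT hρ hIQ hodd h3 hns hHe τ hτ Dt β ι hQ2 hL hk hNPhL)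
    (fun r ℓ hℓ C hC ↦ hK_socket_margin W hΔ hIQ hτ (L := L) (by omega) r k ℓ hℓ C hC)

end Summit.BirchSwinnertonDyer.BirchSwinnertonDyer.Theorems.GenusExact.PlusDescent

end
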